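import Summits.Ventures.PercRepro.S1CFGTrianglesTools

/-!
# PercRepro — THE TRIANGLE CAP AT `n ≥ 2ν + 1`: `c₃ ≤ C(ν + 1, 3) + 1` (p1, gen 39; the `n = 2ν + 1` case)

S1CFGTriangles proves `c₃ ≤ C(ν + 1, 3) + 1` for a simple coloop-free matroid of nullity `ν` on `n ≥ 2ν + 2` points; the
same bound holds at `n = 2ν + 1` (the N-side of the regime `w = ν + 5` with a nullity-`6` residual on `13` points):
* **`ncard_three_eRk_le_two_le_choose_succ_add_one'`** — the cap on `n ≥ 2ν + 1` points;
* `triangles_le_thirtysix_of_nullity_six'` — `c₃ ≤ 36` at `ν = 6` on `n ≥ 13` points.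

THE PROOF of the case `n = 2ν + 1` (`ν ≥ 2`; at `ν ≤ 1` the landed `C(ν + 2, 3)` cap is already `≤ C(ν + 1, 3) + 1`).
`ψ(X) := 2·rk X − |X|`. Take a rank-`2` triple `T₀` and `S ⊇ T₀` MAXIMAL among the PROPER subsets of `E` with `ψ(S) ≤ 1`.
If `S` is triangle-closed the count splits as in S1CFGTriangles (`ncard_le_of_closed`). Otherwise some rank-`2` triple `X`
meets `S` without lying in it; `ψ(S ∪ X) ≤ 1` (the closedness step), so by maximality `S ∪ X = E`: `D := E ∖ S` has `1` or
`2` points. `ψ(S) ≤ 1` and `ν(S) ≤ ν − 1` force `|D| = 2` and `rk S = ν = rk E − 1`; writing `D = {x, y}`, neither `x` nor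
`y` lies in `cl S` (else the other is a coloop). A rank-`2` triple not inside `S` meets `D`; if it contained only `x` it would
be `{x, s, s'}` with `{s, s'} ⊆ S` independent, so `x ∈ cl {s, s'} ⊆ cl S` — impossible; so it contains both `x` and `y`,
and two such, `{x, y, s} ≠ {x, y, s'}`, give `s, s' ∈ cl {x, y}`, hence `x ∈ cl {s, s'} ⊆ cl S` — impossible. So at most
ONE triple lies outside `S`, and `c₃ ≤ C(ν(S) + 2, 3) + 1 ≤ C(ν + 1, 3) + 1`. Nothing about any cell is claimed. Axioms: standard.
-/

open scoped Matroid

namespace PercRepro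

namespace S1CFG

open Set S1CF

variable {α : Type}

/-- **THE TRIANGLE CAP ON `n ≥ 2ν + 1` POINTS**: a simple (no dependent pair), coloop-free matroid of nullity `ν` on
`n ≥ 2ν + 1` points has at most `C(ν + 1, 3) + 1` triangles (`3`-sets of rank `≤ 2`). -/
theorem ncard_three_eRk_le_two_le_choose_succ_add_one' (M : Matroid α) [M.Finite] {ν : ℕ}
    (hd : M.E.encard = M.eRank + (ν : ℕ∞)) (hK : ∀ e, ¬ M.IsColoop e)
    (h0 : {P : Set α | P ⊆ M.E ∧ P.ncard = 2 ∧ M.Dep P}.ncard = 0) (hn : 2 * ν + 1 ≤ M.E.ncard) :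
    {X : Set α | X ⊆ M.E ∧ X.ncard = 3 ∧ M.eRk X ≤ 2}.ncard ≤ (ν + 1).choose 3 + 1 := by
  classical
  rcases Nat.lt_or_ge (2 * ν + 1) M.E.ncard with hlt | hge
  · exact ncard_three_eRk_le_two_le_choose_succ_add_one M hd hK h0 (by omega)
  have hnE' : M.E.ncard = 2 * ν + 1 := by omega
  have hEfin := M.ground_finite
  have hnE := ncard_ground_eq_eRk_toNat_add M hd
  -- small nullity: the landed cap suffices
  rcases Nat.lt_or_ge ν 2 with hν | hν
  · have h := ncard_three_eRk_le_two_le_of_no_dep_pair M hd h0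
    have h2 : (ν + 2).choose 3 ≤ (ν + 1).choose 3 + 1 := by
      interval_cases ν <;> decide
    exact h.trans h2
  set 𝒯 := {X : Set α | X ⊆ M.E ∧ X.ncard = 3 ∧ M.eRk X ≤ 2} with h𝒯
  rcases 𝒯.eq_empty_or_nonempty with h𝒯e | ⟨T₀, hT₀⟩
  · rw [h𝒯e, Set.ncard_empty]; exact Nat.zero_le _
  simp only [h𝒯, Set.mem_setOf_eq] at hT₀
  obtain ⟨hT₀E, hT₀3, hT₀r⟩ := hT₀
  have hT₀r' : (M.eRk T₀).toNat ≤ 2 := by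
    rw [← S1.coe_toNat_eRk M hT₀E] at hT₀r
    exact_mod_cast hT₀r
  -- the family of PROPER `S ⊇ T₀` with `ψ(S) ≤ 1`, and a maximal member
  set 𝒮 := {S : Set α | S ⊆ M.E ∧ T₀ ⊆ S ∧ S ≠ M.E ∧ 2 * (M.eRk S).toNat ≤ S.ncard + 1} with h𝒮
  have h𝒮fin : 𝒮.Finite := hEfin.finite_subsets.subset (fun S hS => hS.1)
  have hT₀ne : T₀ ≠ M.E := by
    intro h
    rw [h] at hT₀3
    omega
  have h𝒮ne : 𝒮.Nonempty := ⟨T₀, hT₀E, subset_refl _, hT₀ne, by omega⟩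
  obtain ⟨S, ⟨hSE, hT₀S, hSne, hψ⟩, hSmax⟩ := h𝒮fin.exists_maximal h𝒮ne
  have hSfin : S.Finite := hEfin.subset hSE
  by_cases hcl : ∀ X, X ⊆ M.E → X.ncard = 3 → M.eRk X ≤ 2 → (S ∩ X).Nonempty → X ⊆ S
  · exact ncard_le_of_closed M hd hK h0 hSE hT₀S hT₀3 hT₀r hSne hcl
  -- the open case: a rank-`2` triple `X` meets `S` and is not inside it
  simp only [not_forall, exists_prop] at hcl
  obtain ⟨X, hXE, hX3, hXr, hSX, hXS⟩ := hcl
  have hXfin : X.Finite := hEfin.subset hXE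
  have hunion : S ∪ X = M.E := by
    by_contra hne
    have hmem : S ∪ X ∈ 𝒮 :=
      ⟨union_subset hSE hXE, hT₀S.trans subset_union_left, hne,
        two_mul_eRk_toNat_union_le_of_inter_nonempty M h0 hSE hXE hX3 hXr hSX hψ⟩
    have hle : S ∪ X ⊆ S := hSmax hmem subset_union_left
    exact hXS (subset_union_right.trans hle)
  -- `D := E ∖ S ⊆ X ∖ S` has one or two points
  have hDX : M.E \ S ⊆ X \ S := by
    intro z hz
    rw [← hunion] at hz
    exact ⟨hz.1.resolve_left hz.2, hz.2⟩
  have hDfin : (M.E \ S).Finite := hEfin.subset sdiff_subset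
  have hXSfin : (X \ S).Finite := hXfin.subset sdiff_subset
  have hXS2 : (X \ S).ncard ≤ 2 := by
    have h1 := Set.ncard_union_add_ncard_inter S X hSfin hXfin
    have h2 : (X \ S).ncard + S.ncard = (S ∪ X).ncard := by
      rw [Set.union_comm, ← Set.union_sdiff_right]
      exact Set.ncard_sdiff_add_ncard_of_subset subset_union_right (hXfin.union hSfin)
    have h3 : 1 ≤ (S ∩ X).ncard := (Set.ncard_pos (hSfin.subset inter_subset_left)).mpr hSX
    omega
  have hD2 : (M.E \ S).ncard ≤ 2 := (Set.ncard_le_ncard hDX hXSfin).trans hXS2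
  have hcardsplit := Set.ncard_sdiff_add_ncard_of_subset hSE hEfin
  have haν : S.ncard + 1 ≤ (M.eRk S).toNat + ν :=
    ncard_add_one_le_eRk_toNat_add_of_ssubset M hd hK hSE hSne
  have hrkS : (M.eRk S).toNat ≤ S.ncard := by
    have := M.eRk_le_encard S
    rw [← S1.coe_toNat_eRk M hSE, ← hSfin.cast_ncard_eq] at this
    exact_mod_cast this
  -- `|D| = 2`, `rk S = ν`, `rk E = ν + 1`
  have hD2' : (M.E \ S).ncard = 2 := by omega
  have hrkSν : (M.eRk S).toNat = ν := by omega
  have hrkE : (M.eRk M.E).toNat = ν + 1 := by omega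
  obtain ⟨x, y, hxy, hDxy⟩ := Set.ncard_eq_two.mp hD2'
  have hxE : x ∈ M.E := (show x ∈ M.E \ S by rw [hDxy]; exact Or.inl rfl).1
  have hyE : y ∈ M.E := (show y ∈ M.E \ S by rw [hDxy]; exact Or.inr rfl).1
  have hxS : x ∉ S := (show x ∈ M.E \ S by rw [hDxy]; exact Or.inl rfl).2
  have hyS : y ∉ S := (show y ∈ M.E \ S by rw [hDxy]; exact Or.inr rfl).2
  have hE_eq : M.E = insert x (insert y S) := by
    ext z
    constructor
    · intro hz
      by_cases hzS : z ∈ S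
      · exact Or.inr (Or.inr hzS)
      · have : z ∈ M.E \ S := ⟨hz, hzS⟩
        rw [hDxy] at this
        rcases this with h | h
        · exact Or.inl h
        · exact Or.inr (Or.inl h)
    · intro hz
      rcases hz with h | h | h
      · rw [h]; exact hxE
      · rw [h]; exact hyE
      · exact hSE h
  -- neither `x` nor `y` lies in `cl S` (else the other is a coloop)
  have hrkE' : M.eRk M.E = ((ν + 1 : ℕ) : ℕ∞) := by
    rw [← S1.coe_toNat_eRk M (subset_refl M.E), hrkE]
  have hrkS' : M.eRk S = ((ν : ℕ) : ℕ∞) := by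
    rw [← S1.coe_toNat_eRk M hSE, hrkSν]
  have hnotcl : ∀ u v : α, u ≠ v → u ∈ M.E → v ∈ M.E → u ∉ S → v ∉ S →
      M.E = insert u (insert v S) → u ∉ M.closure S := by
    intro u v huv huE hvE huS hvS hE hucl
    -- `rk (insert u S) = rk S`, so `v ∉ cl (E ∖ {v})` — a coloop
    have h1 : M.eRk (insert u S) = M.eRk S := by
      rw [← M.eRk_closure_eq (insert u S), Matroid.closure_insert_eq_of_mem_closure hucl,
        M.eRk_closure_eq]
    have hcompl : M.E \ {v} = insert u S := by
      rw [hE]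
      ext z
      simp only [mem_sdiff, mem_insert_iff, mem_singleton_iff]
      constructor
      · rintro ⟨h | h | h, hzv⟩
        · exact Or.inl h
        · exact absurd h hzv
        · exact Or.inr h
      · rintro (h | h)
        · exact ⟨Or.inl h, by rw [h]; exact huv⟩
        · exact ⟨Or.inr (Or.inr h), fun hzv => hvS (hzv ▸ h)⟩
    have hv : M.IsColoop v := by
      rw [Matroid.isColoop_iff_notMem_closure_compl hvE, hcompl]
      intro hvcl
      have h2 : M.eRk M.E = M.eRk (insert u S) := by
        have h3 : M.E = insert v (insert u S) := by
          rw [hE]; exact Set.insert_comm u v S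
        rw [h3, ← M.eRk_closure_eq (insert v (insert u S)),
          Matroid.closure_insert_eq_of_mem_closure hvcl, M.eRk_closure_eq]
      rw [h2, h1, hrkS'] at hrkE'
      have : ν = ν + 1 := by exact_mod_cast hrkE'
      omega
    exact hK v hv
  have hxcl : x ∉ M.closure S := hnotcl x y hxy hxE hyE hxS hyS hE_eq
  have hycl : y ∉ M.closure S := hnotcl y x hxy.symm hyE hxE hyS hxS (by rw [hE_eq]; exact Set.insert_comm x y S)
  -- every rank-`2` triple not inside `S` contains both `x` and `y`
  have hboth : ∀ Y, Y ⊆ M.E → Y.ncard = 3 → M.eRk Y ≤ 2 → ¬ Y ⊆ S → x ∈ Y ∧ y ∈ Y := by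
    intro Y hYE hY3 hYr hYS
    have hYfin : Y.Finite := hEfin.subset hYE
    -- a point `u ∈ Y ∖ S` with the other outside point `v ∉ Y` puts `u ∈ cl S`: impossible
    have key : ∀ u v : α, u ≠ v → u ∈ M.E → v ∈ M.E → u ∉ S → v ∉ S → u ∉ M.closure S →
        M.E = insert u (insert v S) → u ∈ Y → v ∉ Y → False := by
      intro u v huv huE hvE huS hvS hucl hE huY hvY
      have hYsub : Y \ {u} ⊆ S := by
        intro z hz
        have hzE : z ∈ M.E := hYE hz.1
        rw [hE] at hzE
        rcases hzE with h | h | h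
        · exact absurd h hz.2
        · exact absurd (h ▸ hz.1) hvY
        · exact h
      have hP2 : (Y \ {u}).ncard = 2 := by
        have := Set.ncard_sdiff_add_ncard_of_subset (singleton_subset_iff.mpr huY) hYfin
        rw [Set.ncard_singleton] at this
        omega
      have hPind : M.Indep (Y \ {u}) :=
        indep_of_ncard_eq_two_of_no_dep_pair M h0 (hYsub.trans hSE) hP2
      have hY' : insert u (Y \ {u}) = Y := Set.insert_sdiff_singleton.trans (insert_eq_of_mem huY)
      have hmem : u ∈ M.closure (Y \ {u}) :=
        mem_closure_pair_of_eRk_insert_le_two M (hYsub.trans hSE) hPind hP2 huE (by rw [hY']; exact hYr)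
      exact hucl (M.closure_subset_closure hYsub hmem)
    by_cases hxY : x ∈ Y
    · by_cases hyY : y ∈ Y
      · exact ⟨hxY, hyY⟩
      · exact (key x y hxy hxE hyE hxS hyS hxcl hE_eq hxY hyY).elim
    · by_cases hyY : y ∈ Y
      · exact (key y x hxy.symm hyE hxE hyS hxS hycl
          (by rw [hE_eq]; exact Set.insert_comm x y S) hyY hxY).elim
      · -- `Y ⊆ S` after all
        exfalso
        apply hYS
        intro z hz
        have hzE : z ∈ M.E := hYE hz
        rw [hE_eq] at hzE
        rcases hzE with h | h | h
        · exact absurd (h ▸ hz) hxY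
        · exact absurd (h ▸ hz) hyY
        · exact h
  -- hence at most ONE rank-`2` triple lies outside `S`
  have hxy_ind : M.Indep {x, y} :=
    indep_of_ncard_eq_two_of_no_dep_pair M h0 (by
      intro z hz; rcases hz with h | h
      · rw [h]; exact hxE
      · rw [mem_singleton_iff.mp h]; exact hyE) (Set.ncard_pair hxy)
  have hone : {Y : Set α | Y ⊆ M.E ∧ Y.ncard = 3 ∧ M.eRk Y ≤ 2 ∧ ¬ Y ⊆ S}.ncard ≤ 1 := by
    rw [Set.ncard_le_one_iff (hEfin.finite_subsets.subset (fun Y hY => hY.1))]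
    rintro Y Y' ⟨hYE, hY3, hYr, hYS⟩ ⟨hY'E, hY'3, hY'r, hY'S⟩
    obtain ⟨hxY, hyY⟩ := hboth Y hYE hY3 hYr hYS
    obtain ⟨hxY', hyY'⟩ := hboth Y' hY'E hY'3 hY'r hY'S
    have hYfin : Y.Finite := hEfin.subset hYE
    have hY'fin : Y'.Finite := hEfin.subset hY'E
    have hpairY : ({x, y} : Set α) ⊆ Y := by
      intro z hz; rcases hz with h | h
      · rw [h]; exact hxY
      · rw [mem_singleton_iff.mp h]; exact hyY
    have hpairY' : ({x, y} : Set α) ⊆ Y' := by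
      intro z hz; rcases hz with h | h
      · rw [h]; exact hxY'
      · rw [mem_singleton_iff.mp h]; exact hyY'
    -- the third points
    have h1 : (Y \ {x, y}).ncard = 1 := by
      have := Set.ncard_sdiff_add_ncard_of_subset hpairY hYfin
      rw [Set.ncard_pair hxy] at this
      omega
    have h1' : (Y' \ {x, y}).ncard = 1 := by
      have := Set.ncard_sdiff_add_ncard_of_subset hpairY' hY'fin
      rw [Set.ncard_pair hxy] at this
      omega
    obtain ⟨s, hs⟩ := Set.ncard_eq_one.mp h1
    obtain ⟨s', hs'⟩ := Set.ncard_eq_one.mp h1'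
    have hsY : s ∈ Y \ {x, y} := by rw [hs]; rfl
    have hs'Y : s' ∈ Y' \ {x, y} := by rw [hs']; rfl
    have hYeq : Y = insert s {x, y} := by
      rw [← Set.union_sdiff_cancel hpairY, hs, Set.union_comm, Set.singleton_union]
    have hY'eq : Y' = insert s' {x, y} := by
      rw [← Set.union_sdiff_cancel hpairY', hs', Set.union_comm, Set.singleton_union]
    -- the third points lie in `S` (they are neither `x` nor `y`)
    have hsS : s ∈ S := by
      have hsE : s ∈ M.E := hYE hsY.1
      rw [hE_eq] at hsE
      rcases hsE with h | h | h
      · exact absurd (Or.inl h) hsY.2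
      · exact absurd (Or.inr h) hsY.2
      · exact h
    have hs'S : s' ∈ S := by
      have hsE : s' ∈ M.E := hY'E hs'Y.1
      rw [hE_eq] at hsE
      rcases hsE with h | h | h
      · exact absurd (Or.inl h) hs'Y.2
      · exact absurd (Or.inr h) hs'Y.2
      · exact h
    by_contra hne
    have hss' : s ≠ s' := by
      intro h; apply hne; rw [hYeq, hY'eq, h]
    -- `s, s' ∈ cl {x, y}`, so `x ∈ cl {s, s'} ⊆ cl S`
    have hpairE : ({x, y} : Set α) ⊆ M.E := hpairY.trans hYE
    have hscl : s ∈ M.closure {x, y} :=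
      mem_closure_pair_of_eRk_insert_le_two M hpairE hxy_ind (Set.ncard_pair hxy) (hSE hsS)
        (by rw [← hYeq]; exact hYr)
    have hs'cl : s' ∈ M.closure {x, y} :=
      mem_closure_pair_of_eRk_insert_le_two M hpairE hxy_ind (Set.ncard_pair hxy) (hSE hs'S)
        (by rw [← hY'eq]; exact hY'r)
    have hss'cl : ({s, s'} : Set α) ⊆ M.closure {x, y} := by
      intro z hz; rcases hz with h | h
      · rw [h]; exact hscl
      · rw [mem_singleton_iff.mp h]; exact hs'cl
    have hss'E : ({s, s'} : Set α) ⊆ M.E := by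
      intro z hz; rcases hz with h | h
      · rw [h]; exact hSE hsS
      · rw [mem_singleton_iff.mp h]; exact hSE hs'S
    have hss'S : ({s, s'} : Set α) ⊆ S := by
      intro z hz; rcases hz with h | h
      · rw [h]; exact hsS
      · rw [mem_singleton_iff.mp h]; exact hs'S
    have hss'ind : M.Indep {s, s'} := indep_of_ncard_eq_two_of_no_dep_pair M h0 hss'E (Set.ncard_pair hss')
    -- `rk ({s, s'} ∪ {x, y}) = rk {x, y} = 2`, so `rk (insert x {s, s'}) ≤ 2`
    have hU : M.eRk ({s, s'} ∪ {x, y}) = M.eRk {x, y} :=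
      eRk_union_eq_of_subset_closure M hpairE hss'cl
    have hxy2 : M.eRk {x, y} = 2 := by
      rw [hxy_ind.eRk_eq_encard, Set.encard_pair hxy]
    have hins : M.eRk (insert x {s, s'}) ≤ 2 := by
      have hsub : (insert x {s, s'} : Set α) ⊆ ({s, s'} ∪ {x, y} : Set α) := by
        intro z hz; rcases hz with h | h
        · exact Or.inr (Or.inl h)
        · exact Or.inl h
      exact (M.eRk_mono hsub).trans (by rw [hU, hxy2])
    have hxcl' : x ∈ M.closure {s, s'} :=
      mem_closure_pair_of_eRk_insert_le_two M hss'E hss'ind (Set.ncard_pair hss') hxE hins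
    exact hxcl (M.closure_subset_closure hss'S hxcl')
  -- assemble: the triples inside `S` and the (at most one) outside
  have hsplit : 𝒯 ⊆ {Y : Set α | Y ⊆ S ∧ Y.ncard = 3 ∧ M.eRk Y ≤ 2} ∪
      {Y : Set α | Y ⊆ M.E ∧ Y.ncard = 3 ∧ M.eRk Y ≤ 2 ∧ ¬ Y ⊆ S} := by
    intro Y hY
    simp only [h𝒯, Set.mem_setOf_eq] at hY
    obtain ⟨hYE, hY3, hYr⟩ := hY
    by_cases hYS : Y ⊆ S
    · exact Or.inl ⟨hYS, hY3, hYr⟩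
    · exact Or.inr ⟨hYE, hY3, hYr, hYS⟩
  have hcount : 𝒯.ncard ≤ {Y : Set α | Y ⊆ S ∧ Y.ncard = 3 ∧ M.eRk Y ≤ 2}.ncard +
      {Y : Set α | Y ⊆ M.E ∧ Y.ncard = 3 ∧ M.eRk Y ≤ 2 ∧ ¬ Y ⊆ S}.ncard := by
    refine (Set.ncard_le_ncard hsplit ?_).trans (Set.ncard_union_le _ _)
    exact (hEfin.finite_subsets.subset (fun Y hY => hY.1.trans hSE)).union
      (hEfin.finite_subsets.subset (fun Y hY => hY.1))
  have hcapS := ncard_three_eRk_le_two_le_of_no_dep_pair_restrict M h0 hSE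
  have hcapS' : (S.ncard - (M.eRk S).toNat + 2).choose 3 ≤ (ν + 1).choose 3 :=
    Nat.choose_le_choose 3 (by omega)
  omega

/-- The triangle cap at nullity `6` on `≥ 13` points: `c₃ ≤ 36`. -/
theorem triangles_le_thirtysix_of_nullity_six' (M : Matroid α) [M.Finite]
    (hd : M.E.encard = M.eRank + ((6 : ℕ) : ℕ∞)) (hK : ∀ e, ¬ M.IsColoop e)
    (h0 : {P : Set α | P ⊆ M.E ∧ P.ncard = 2 ∧ M.Dep P}.ncard = 0) (hn : 13 ≤ M.E.ncard) :
    {X : Set α | X ⊆ M.E ∧ X.ncard = 3 ∧ M.eRk X ≤ 2}.ncard ≤ 36 := by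
  have h := ncard_three_eRk_le_two_le_choose_succ_add_one' M hd hK h0 (by omega)
  exact h.trans (by decide)

end S1CFG

end PercRepro
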